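import Summits.NavierStokesRegularity.FunctionalMining.StretchingClassConst
import HarnessLib

/-!
# FunctionalMining — K1-Q1 beyond the classes: the bank's filler/wrap theorems as TYPED TARGETS with proved assembly (dict seat, staged)

NS FUNCTIONAL MINING cell (`pub-nsfunc`), dictionary seat gen 7 — **search for candidate a priori
estimates; no regularity claim.** STATIC field inequalities only: nothing about Navier–Stokes solutions
is asserted anywhere in this file.

The bank's hand theorems on the K1-Q1 constant `C⋆ = stretchingSupConst` (`pub-nsfunc-bank/K1Q1-HALF.md`,
[ours, UNREVIEWED beyond the cell; audited by census-2 `NESTED-CHECK2.md`]) are LIMIT CONSTRUCTIONS. This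
file does NOT prove them. It TYPES them as two `@[conjecture]` obligation nodes stated purely through field
STATISTICS — so that a prover can discharge each by ANY construction — and PROVES the assembly to the headline
numbers in the kernel:

* `PlanarCellFamily` (bank Thm 1 / Thm 2, §2–§3, §8): 2½-D fields with `|ω| ≤ 1`, production `→ 1/4`,
  enstrophy `→ 1/2`; `PlanarFillerFamily`: the same with the vorticity second-moment split
  `T₂₂ − T₃₃ → 1/4` (bank Cor. 3.1: tubes along `e₂` carry `1/2`, the wave vorticity splits `1/4 + 1/4`).
* `WrapLowerBound` (bank THEOREM 3, §9.3, the "wrap lemma"): for every smooth divergence-free filler `F`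
  with `|Ω_F| ≤ 1` and every `Λ ∈ (0, 1/2]`,
  `C⋆ ≥ R(Λ;F) := [Λ(T₂₂(F) − T₃₃(F)) + π_F] / [2(Λ² + e_F/2)]`
  (`π_F = enstrophyProduction F`, `e_F = torusEnstrophy F`, `T_ii(F) = ∫(Ω_F)ᵢ²`).

PROVED here (kernel, modulo the two nodes as hypotheses):
* `PlanarCellFamily → stretchingSupConstOn IsTwoHalfD = 1/2` (with the staged upper half
  `stretchingSupConstOn_isTwoHalfD_le_half`): **the 2½-D class constant is exactly `1/2`**;
* `WrapLowerBound → PlanarFillerFamily → (2+√5)/8 ≤ C⋆` (bank Cor. 3.1: optimise `R(Λ;F_ε)` at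
  `Λ⋆ = (√5−2)/2`, pass to the limit `ε → 0`; the algebra `(1+Λ⋆)/(2+8Λ⋆²) = (2+√5)/8` is checked);
* `(2+√5)/8 ≤ C⋆ → stretchingSupConstOn IsTwoHalfD < C⋆`: **conditionally on the two nodes the K1-Q1
  extremal problem is genuinely three-dimensional** (`1/2 < 0.5295…`).
The VALUE of `C⋆ ∈ [kernel 0.2381 (tree) / 2√3/9 (pending), 2/√3]` stays open; the bank records no conjecture about it.
[ours; the nodes are internal hand theorems, NOT literature facts — LEAN PLACEMENT RULE respected]
-/

noncomputable section

open Set Filter Topology MeasureTheory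

namespace Summit.NavierStokesRegularity.FunctionalMining

open Literature.Analysis Literature.Analysis.FunctionSpaces Literature.Analysis.FunctionSpaces.Torus
open Literature.Analysis.FluidPDE

/-! ## 1. Vorticity components and second moments on `T³` -/

/-- The vorticity VECTOR `ω = curl v` at a point of the unit 3-torus, `0`-indexed:
`ω₀ = ∂₁v₂ − ∂₂v₁`, `ω₁ = ∂₂v₀ − ∂₀v₂`, `ω₂ = ∂₀v₁ − ∂₁v₀`. [ours; bookkeeping] -/
def vorticityComp (v : UnitAddTorus (Fin 3) → EuclideanSpace ℝ (Fin 3)) (x : UnitAddTorus (Fin 3)) :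
    Fin 3 → ℝ :=
  ![Torus.partialDeriv 1 v x 2 - Torus.partialDeriv 2 v x 1,
    Torus.partialDeriv 2 v x 0 - Torus.partialDeriv 0 v x 2,
    Torus.partialDeriv 0 v x 1 - Torus.partialDeriv 1 v x 0]

/-- `|ω(x)|² = ω₀² + ω₁² + ω₂²`: the tree's `torusVorticitySqAt` (`½∑ᵢⱼ(∂ᵢvⱼ − ∂ⱼvᵢ)²`) in components.
[ours; bookkeeping] -/
theorem torusVorticitySqAt_eq_sum_sq (v : UnitAddTorus (Fin 3) → EuclideanSpace ℝ (Fin 3))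
    (x : UnitAddTorus (Fin 3)) :
    torusVorticitySqAt v x = ∑ i, vorticityComp v x i ^ 2 := by
  simp only [torusVorticitySqAt, vorticityComp, Fin.sum_univ_three, Matrix.cons_val_zero,
    Matrix.cons_val_one, Matrix.head_cons, Matrix.cons_val_two, Matrix.tail_cons]
  ring

/-- The vorticity second-moment tensor `T_ij(v) := ∫_{T³} ωᵢ ωⱼ` (bank K1Q1-HALF §9.1: `tr T = 2ℰ`).
Junk value `0` if not integrable (never the case for smooth `v`). [ours; bookkeeping] -/
def vorticityMoment (v : UnitAddTorus (Fin 3) → EuclideanSpace ℝ (Fin 3)) (i j : Fin 3) : ℝ :=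
  ∫ x, vorticityComp v x i * vorticityComp v x j

/-- The bank's wrap ratio `R(Λ;F) := [Λ(T₁₁(F) − T₂₂(F)) + π_F] / [2(Λ² + e_F/2)]` (`0`-indexed moments:
the bank's `T₂₂ − T₃₃`; `π_F = enstrophyProduction F`, `e_F = torusEnstrophy F`). [ours; bookkeeping] -/
def wrapRatio (Λ : ℝ) (F : UnitAddTorus (Fin 3) → EuclideanSpace ℝ (Fin 3)) : ℝ :=
  (Λ * (vorticityMoment F 1 1 - vorticityMoment F 2 2) + enstrophyProduction F) /
    (2 * (Λ ^ 2 + torusEnstrophy F / 2))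

/-! ## 2. The two obligation nodes (bank hand theorems, typed through statistics) -/

/-- **NODE (bank K1Q1-HALF Thm 1 / Thm 2 / §8, typed by statistics): the planar cellular family.** For every
`ε > 0` there is a smooth divergence-free 2½-D field on `T³` with `|ω| ≤ 1` pointwise, enstrophy production
`≥ 1/4 − ε` and enstrophy `≤ 1/2 + ε` (bank: cellular strain cells loaded with envelope-confined aligned
waves, `σ → M³|A|/4`, `ℰ → M²|A|/2` with `|A| → 1`; or the EXACT trigonometric-polynomial members
`u_{n,n′,θ,m}` of §8 with `r → 1/2`). Internal hand theorem, UNPROVED in the kernel. Search for candidate a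
priori estimates; no regularity claim. [ours] -/
@[conjecture] def PlanarCellFamily : Prop :=
  ∀ ε : ℝ, 0 < ε → ∃ F : UnitAddTorus (Fin 3) → EuclideanSpace ℝ (Fin 3),
    Torus.IsSmooth F ∧ Torus.IsDivFree F ∧ IsTwoHalfD F ∧ (∀ x, torusVorticitySqAt F x ≤ 1) ∧
      1 / 4 - ε ≤ enstrophyProduction F ∧ torusEnstrophy F ≤ 1 / 2 + ε

/-- **NODE (bank K1Q1-HALF Cor. 3.1 input, typed by statistics): the planar family as a FILLER.** As
`PlanarCellFamily`, oriented with its vortex tubes along `e₁` (`0`-indexed; the bank's `e₂`), and with the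
second-moment split `T₁₁ − T₂₂ ≥ 1/4 − ε` (tubes carry `→ 1/2`, the wave vorticity splits equally between
the two other axes, `→ 1/4` each, by the `y₁ ↔ y₂` symmetry of the §2 field). Internal hand theorem,
UNPROVED in the kernel. Search for candidate a priori estimates; no regularity claim. [ours] -/
@[conjecture] def PlanarFillerFamily : Prop :=
  ∀ ε : ℝ, 0 < ε → ∃ F : UnitAddTorus (Fin 3) → EuclideanSpace ℝ (Fin 3),
    Torus.IsSmooth F ∧ Torus.IsDivFree F ∧ IsTwoHalfD F ∧ (∀ x, torusVorticitySqAt F x ≤ 1) ∧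
      1 / 4 - ε ≤ enstrophyProduction F ∧ torusEnstrophy F ≤ 1 / 2 + ε ∧
        1 / 4 - ε ≤ vorticityMoment F 1 1 - vorticityMoment F 2 2

/-- **NODE (bank K1Q1-HALF THEOREM 3, the WRAP LEMMA, §9.3):** for every smooth divergence-free filler `F`
on `T³` with `|Ω_F| ≤ 1` pointwise and every `Λ ∈ (0, 1/2]`, `R(Λ;F) ≤ C⋆` — realised in the bank's proof
by wrapping the rescaled filler `m⁻¹F(m·)`, confined through its vector potential, into the vorticity-free
`±ΛD` strain cells of the diagonal crossed-shear flow `v₂` and letting `m → ∞`, then the plateaus `→`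
indicators (two-scale lemma, Haar push-forward, periodic vector potential). Internal hand theorem, UNPROVED
in the kernel (census-2 NESTED-CHECK2 audited the hand proof). Search for candidate a priori estimates; no
regularity claim. [ours] -/
@[conjecture] def WrapLowerBound : Prop :=
  ∀ F : UnitAddTorus (Fin 3) → EuclideanSpace ℝ (Fin 3),
    Torus.IsSmooth F → Torus.IsDivFree F → (∀ x, torusVorticitySqAt F x ≤ 1) →
      ∀ Λ : ℝ, 0 < Λ → Λ ≤ 1 / 2 → wrapRatio Λ F ≤ stretchingSupConst (d := Fin 3)

/-- **TARGET (bank Cor. 3.1): `(2+√5)/8 ≤ C⋆`** (`≈ 0.5295 > 1/2`). Internal hand theorem, UNPROVED in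
the kernel; `nestedLowerBound_of_wrap` derives it from the two nodes. Search for candidate a priori
estimates; no regularity claim. [ours] -/
@[conjecture] def NestedLowerBound : Prop :=
  (2 + Real.sqrt 5) / 8 ≤ stretchingSupConst (d := Fin 3)

/-- The filler node refines the cell node. [ours; elementary] -/
theorem PlanarFillerFamily.planarCellFamily (h : PlanarFillerFamily) : PlanarCellFamily := by
  intro ε hε
  obtain ⟨F, hF, hdiv, h25, hω, hπ, he, -⟩ := h ε hε
  exact ⟨F, hF, hdiv, h25, hω, hπ, he⟩

/-! ## 3. Assembly I: the planar family decides the 2½-D class constant -/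

/-- **`PlanarCellFamily → ¬ StretchingSupBoundOn IsTwoHalfD C` for every `C < 1/2`.** [ours] -/
theorem not_stretchingSupBoundOn_isTwoHalfD_of_planarCellFamily (h : PlanarCellFamily) {C : ℝ}
    (hC : C < 1 / 2) : ¬ StretchingSupBoundOn (IsTwoHalfD (d := Fin 3)) C := by
  intro hOn
  rcases le_or_gt C 0 with hC0 | hC0
  · obtain ⟨F, hF, hdiv, h25, hω, hπ, he⟩ := h (1 / 8) (by norm_num)
    have hle := hOn (Fintype.card_fin 3) F hF hdiv h25 1 zero_le_one (fun x => by rw [one_pow]; exact hω x)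
    have hE := torusEnstrophy_nonneg F
    nlinarith
  · obtain ⟨ε, hε, hεdef⟩ : ∃ ε : ℝ, 0 < ε ∧ ε = (1 / 4 - C / 2) / (2 * (1 + C)) :=
      ⟨_, by apply div_pos <;> linarith, rfl⟩
    obtain ⟨F, hF, hdiv, h25, hω, hπ, he⟩ := h ε hε
    have hle := hOn (Fintype.card_fin 3) F hF hdiv h25 1 zero_le_one (fun x => by rw [one_pow]; exact hω x)
    have hE := torusEnstrophy_nonneg F
    have h1 : ε * (2 * (1 + C)) = 1 / 4 - C / 2 := by
      rw [hεdef, div_mul_cancel₀]; positivity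
    nlinarith

/-- **`PlanarCellFamily → C_{2.5D} = 1/2`**: together with the staged upper half
(`stretchingSupConstOn_isTwoHalfD_le_half`, dict (u)/(v)) the bank's planar family decides the 2½-D class
constant exactly. Search for candidate a priori estimates; no regularity claim. [ours] -/
theorem stretchingSupConstOn_isTwoHalfD_eq_half_of_planarCellFamily (h : PlanarCellFamily) :
    stretchingSupConstOn (IsTwoHalfD (d := Fin 3)) = 1 / 2 :=
  le_antisymm stretchingSupConstOn_isTwoHalfD_le_half
    (le_stretchingSupConstOn_of_forall_lt fun _ hC =>
      not_stretchingSupBoundOn_isTwoHalfD_of_planarCellFamily h hC)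

/-- The converse direction is unconditional bookkeeping: `C_{2.5D} = 1/2` says exactly that every `C < 1/2`
is violated inside the class. [ours; elementary] -/
theorem stretchingSupConstOn_isTwoHalfD_eq_half_iff :
    stretchingSupConstOn (IsTwoHalfD (d := Fin 3)) = 1 / 2 ↔
      ∀ C < (1 : ℝ) / 2, ¬ StretchingSupBoundOn (IsTwoHalfD (d := Fin 3)) C := by
  constructor
  · intro h C hC hOn
    have := stretchingSupConstOn_le not_stretchingSupBoundOn_isTwoHalfD_zero hOn
    linarith
  · intro h
    exact le_antisymm stretchingSupConstOn_isTwoHalfD_le_half (le_stretchingSupConstOn_of_forall_lt h)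

/-! ## 4. Assembly II: wrap lemma + planar filler ⇒ `C⋆ ≥ (2+√5)/8` (bank Cor. 3.1) -/

/-- The optimal outer strain amplitude `Λ⋆ = (√5 − 2)/2 ≈ 0.118` (root of `4Λ² + 8Λ − 1`). [ours] -/
def lambdaStar : ℝ := (Real.sqrt 5 - 2) / 2

/-- `0 < Λ⋆`. [ours; elementary] -/
theorem lambdaStar_pos : 0 < lambdaStar := by
  have h4 : (2 : ℝ) < Real.sqrt 5 := by
    rw [show (2 : ℝ) = Real.sqrt 4 by rw [show (4 : ℝ) = 2 ^ 2 by norm_num, Real.sqrt_sq (by norm_num)]]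
    exact Real.sqrt_lt_sqrt (by norm_num) (by norm_num)
  unfold lambdaStar; linarith

/-- `Λ⋆ ≤ ½`. [ours; elementary] -/
theorem lambdaStar_le_half : lambdaStar ≤ 1 / 2 := by
  have h9 : Real.sqrt 5 ≤ 3 := by
    rw [show (3 : ℝ) = Real.sqrt 9 by rw [show (9 : ℝ) = 3 ^ 2 by norm_num, Real.sqrt_sq (by norm_num)]]
    exact Real.sqrt_le_sqrt (by norm_num)
  unfold lambdaStar; linarith

/-- The guaranteed wrap ratio at tolerance `ε`: `ρ(ε) := [Λ⋆(1/4 − ε) + (1/4 − ε)] / [2(Λ⋆² + 1/4 + ε/2)]`. [ours] -/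
def wrapFloor (ε : ℝ) : ℝ :=
  (lambdaStar * (1 / 4 - ε) + (1 / 4 - ε)) / (2 * (lambdaStar ^ 2 + 1 / 4 + ε / 2))

/-- `ρ(0) = (1+Λ⋆)/(2+8Λ⋆²) = (2+√5)/8` (bank §9.2: `r(Λ⋆)`). [ours; elementary] -/
theorem wrapFloor_zero : wrapFloor 0 = (2 + Real.sqrt 5) / 8 := by
  have h5 : Real.sqrt 5 * Real.sqrt 5 = 5 := Real.mul_self_sqrt (by norm_num)
  have h9 : Real.sqrt 5 ≤ 3 := by
    rw [show (3 : ℝ) = Real.sqrt 9 by rw [show (9 : ℝ) = 3 ^ 2 by norm_num, Real.sqrt_sq (by norm_num)]]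
    exact Real.sqrt_le_sqrt (by norm_num)
  have hden : 0 < 2 * (lambdaStar ^ 2 + 1 / 4 + 0 / 2) := by positivity
  unfold wrapFloor
  rw [div_eq_div_iff hden.ne' (by norm_num)]
  unfold lambdaStar
  nlinarith [h5]

/-- `wrapFloor` is continuous at `0`. [ours; elementary] -/
theorem continuousAt_wrapFloor_zero : ContinuousAt wrapFloor 0 := by
  unfold wrapFloor
  have hden : (2 * (lambdaStar ^ 2 + 1 / 4 + (0 : ℝ) / 2)) ≠ 0 := by positivity
  exact ContinuousAt.div (by fun_prop) (by fun_prop) hden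

/-- For `0 < ε ≤ 1/8`, the filler at tolerance `ε` has wrap ratio `≥ ρ(ε)` at `Λ⋆`. [ours] -/
theorem wrapFloor_le_wrapRatio {ε : ℝ} (hε : 0 < ε) (hε' : ε ≤ 1 / 8)
    {F : UnitAddTorus (Fin 3) → EuclideanSpace ℝ (Fin 3)}
    (hπ : 1 / 4 - ε ≤ enstrophyProduction F) (he : torusEnstrophy F ≤ 1 / 2 + ε)
    (hT : 1 / 4 - ε ≤ vorticityMoment F 1 1 - vorticityMoment F 2 2) :
    wrapFloor ε ≤ wrapRatio lambdaStar F := by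
  have hΛ := lambdaStar_pos
  have hE := torusEnstrophy_nonneg F
  have hD : 0 < 2 * (lambdaStar ^ 2 + torusEnstrophy F / 2) := by positivity
  have hD' : 0 < 2 * (lambdaStar ^ 2 + 1 / 4 + ε / 2) := by positivity
  have hN' : 0 ≤ lambdaStar * (1 / 4 - ε) + (1 / 4 - ε) := by
    have : 0 ≤ 1 / 4 - ε := by linarith
    positivity
  have hNN : lambdaStar * (1 / 4 - ε) + (1 / 4 - ε) ≤
      lambdaStar * (vorticityMoment F 1 1 - vorticityMoment F 2 2) + enstrophyProduction F := by
    nlinarith [mul_le_mul_of_nonneg_left hT hΛ.le]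
  unfold wrapFloor wrapRatio
  rw [div_le_div_iff₀ hD' hD]
  have hDD : 2 * (lambdaStar ^ 2 + torusEnstrophy F / 2) ≤ 2 * (lambdaStar ^ 2 + 1 / 4 + ε / 2) := by
    linarith
  calc (lambdaStar * (1 / 4 - ε) + (1 / 4 - ε)) * (2 * (lambdaStar ^ 2 + torusEnstrophy F / 2))
      ≤ (lambdaStar * (1 / 4 - ε) + (1 / 4 - ε)) * (2 * (lambdaStar ^ 2 + 1 / 4 + ε / 2)) :=
        mul_le_mul_of_nonneg_left hDD hN'
    _ ≤ (lambdaStar * (vorticityMoment F 1 1 - vorticityMoment F 2 2) + enstrophyProduction F) *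
          (2 * (lambdaStar ^ 2 + 1 / 4 + ε / 2)) :=
        mul_le_mul_of_nonneg_right hNN hD'.le

/-- **`WrapLowerBound → PlanarFillerFamily → (2+√5)/8 ≤ C⋆`** (bank Cor. 3.1, assembly checked in the
kernel: `ρ(ε) ≤ R(Λ⋆;F_ε) ≤ C⋆` for all small `ε`, `ρ` continuous at `0`, `ρ(0) = (2+√5)/8`). Search for
candidate a priori estimates; no regularity claim. [ours] -/
theorem nestedLowerBound_of_wrap (hW : WrapLowerBound) (hP : PlanarFillerFamily) : NestedLowerBound := by
  unfold NestedLowerBound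
  rw [← wrapFloor_zero]
  have ht : Tendsto wrapFloor (𝓝[>] 0) (𝓝 (wrapFloor 0)) :=
    continuousAt_wrapFloor_zero.tendsto.mono_left nhdsWithin_le_nhds
  refine le_of_tendsto ht ?_
  filter_upwards [Ioc_mem_nhdsGT (by norm_num : (0 : ℝ) < 1 / 8)] with ε hε
  obtain ⟨F, hF, hdiv, -, hω, hπ, he, hT⟩ := hP ε hε.1
  exact (wrapFloor_le_wrapRatio hε.1 hε.2 hπ he hT).trans
    (hW F hF hdiv hω lambdaStar lambdaStar_pos lambdaStar_le_half)

/-- `1/2 < (2+√5)/8`. [ours; elementary] -/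
theorem half_lt_nested_const : (1 : ℝ) / 2 < (2 + Real.sqrt 5) / 8 := by
  have h4 : (2 : ℝ) < Real.sqrt 5 := by
    rw [show (2 : ℝ) = Real.sqrt 4 by rw [show (4 : ℝ) = 2 ^ 2 by norm_num, Real.sqrt_sq (by norm_num)]]
    exact Real.sqrt_lt_sqrt (by norm_num) (by norm_num)
  linarith

/-- **Conditionally, K1-Q1 is genuinely three-dimensional**: `(2+√5)/8 ≤ C⋆ → C_{2.5D} < C⋆` (the 2½-D
class constant is `≤ 1/2` in the kernel, dict (u)/(v)). Search for candidate a priori estimates; no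
regularity claim. [ours] -/
theorem stretchingSupConstOn_isTwoHalfD_lt_of_nested (h : NestedLowerBound) :
    stretchingSupConstOn (IsTwoHalfD (d := Fin 3)) < stretchingSupConst (d := Fin 3) :=
  (stretchingSupConstOn_isTwoHalfD_le_half.trans_lt half_lt_nested_const).trans_le h

/-- The same from the two nodes. [ours] -/
theorem stretchingSupConstOn_isTwoHalfD_lt_of_wrap (hW : WrapLowerBound) (hP : PlanarFillerFamily) :
    stretchingSupConstOn (IsTwoHalfD (d := Fin 3)) < stretchingSupConst (d := Fin 3) :=
  stretchingSupConstOn_isTwoHalfD_lt_of_nested (nestedLowerBound_of_wrap hW hP)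

/-- **Recording form**: `(2+√5)/8 ≤ C⋆ ↔ ∀ C < (2+√5)/8, ¬ StretchingSupBound C`. [ours; elementary] -/
theorem nestedLowerBound_iff :
    NestedLowerBound ↔ ∀ C < (2 + Real.sqrt 5) / 8, ¬ StretchingSupBound (d := Fin 3) C := by
  constructor
  · intro h C hC hB
    have hq : ¬ StretchingSupBound (d := Fin 3) 0 :=
      StretchFamily.not_stretchingSupBound_of_lt_sqrt_three_div_nine (by positivity)
    have := stretchingSupConst_le (bddBelow_stretchingSupValid hq) hB
    exact absurd (hC.trans_le (h.trans this)) (lt_irrefl C)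
  · exact fun h => le_of_forall_lt_imp_le_of_dense fun C hC => le_stretchingSupConst (h C hC)

end Summit.NavierStokesRegularity.FunctionalMining

end
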